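import Literature.NumberTheory.EllipticCurves.OrdinaryReductionTateModuleProofs
import Literature.NumberTheory.EllipticCurves.FramedTateGaloisRep
import Literature.NumberTheory.GaloisRepresentations.OrdinaryGaloisRep
import Literature.NumberTheory.Automorphic.CDTTheorem722
import HarnessLib

/-!
# Stub ideation k3 · GEN 7 · `stub_liftThree` (crux `FreyModularity`, stmt-ABC-11340, line `Sketch`)

HOME FAMILY 3 — PROBE THE EXTREMES, technique (e) PERTURBATION FROM A PROVED NEIGHBOUR (+ (c) the
extremal local configurations, carried from GEN 6).  Companion file: elaboration sanity only; every
`sorry` below is a PROPOSED HELPER LEMMA (none registered, nothing touches `Lines/Sketch.lean`);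
supersedes nothing — GEN 6 (`STUB_IDEAS_stub_liftThree_3g6.lean`: E3/E4/W0–W2) stays valid by reference.

The stub (S1b, `Lines/Sketch.lean:157`):
`∀ W ρ, W.IsTorsionGaloisRep 3 ρ → ρ.IsAbsIrreducibleOverSqrt (-3) → ¬ 9 ∣ N_W → ρ.IsModular →
   W.IsModularGaloisRepTate 3`  (Conrad–Diamond–Taylor 1999 Thm. 7.2.1 ∩ {9 ∤ N}; Wiles / Taylor–Wiles /
Diamond `R_𝒟 = T_𝒟` at `ℓ = 3`).

WHAT GEN 7 ADDS.  GEN 6 read `h9 : ¬ 9 ∣ N_W` on the RESIDUAL side (Serre weight `k(ρ̄) ∈ {2, 4}`).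
The lifting theorem also consumes `h9` on the DEFORMATION side: `ρ_{W,3} ⊗ 𝒪` must be a lift of
TYPE `𝒟` — FLAT at `3` (Wiles (ii)(b)) or ORDINARY ("Selmer") at `3` (Wiles (ii)(a)) — and which one is
decided by the 2 × 2 table FLAT × ORDINARY of `ρ_{W,3}|G_{ℚ₃}` for `W` semistable at `3`:

* (α) good supersingular: flat, NOT ordinary (`ρ̄|G₃` absolutely irreducible; `D₃ = flat`, `3 ∉ Σ`);
* (γ) good ordinary: flat AND ordinary (`D₃ = flat` or `ord`, `3 ∉ Σ`);
* (β₀) multiplicative peu ramifié (`3 ∣ ord₃ Δ_min`): `ρ̄` flat, `ρ` ordinary NOT flat (`3 ∈ Σ`, the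
  `q = ℓ = 3` level-raising step of k2's Σ-induction);
* (β₁) multiplicative très ramifié: ordinary, `ρ̄` not flat (`D₃ = ord`, `3 ∈ Σ` forced, `k(ρ̄) = 4`);
* the fourth corner "neither flat nor ordinary" is EMPTY ⟺ `W` semistable at `3` ⟺ `9 ∤ N_W`
  (additive potentially-good supersingular `W` at `3` would sit there: CDT's potentially Barsotti–Tate
  types / Savitt — exactly what `h9` excludes).

The ORDINARY column is obtained by PERTURBING A PROVED NEIGHBOUR: the tree PROVES the ordinary
filtration of `V_p E` at a place of GOOD ORDINARY reduction
(`ellipticOrdinaryReduction_tateModule_filtration_holds`, Greenberg 1991 §2) and PROVES Tate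
uniformisation at (split / non-split) MULTIPLICATIVE places
(`Silverman1994_thmV53_tateUniformisation_holds`, `…corV54…` twisted); the multiplicative filtration (L2
below) has the SAME conclusion shape, so one predicate `HasOrdinaryLineAt` covers cells (β₀), (β₁), (γ),
and its framed form is the tree's Skinner–Wiles predicate `FramedGaloisRep.IsOrdinaryOfWeightAt 3 ρ v 2 1`
(L2f).  The FLAT column at the residual level is decided by the second PROVED fact
`ordinaryReduction_of_inertiaFixed_pTorsion_holds` (Serre 1972 §1.11–1.12, `e(3) = 1 < ℓ - 1 = 2`):
supersingular ⇒ `E[3]` has no non-zero inertia-fixed point (L3a); the flat LIFT condition itself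
(`E[3ⁿ]|G_{ℚ₃}` prolongs to a finite flat `ℤ₃`-group scheme, Conrad 1997 Intro.) has NO tree predicate —
definition request D1 in the plan (`STUB-IDEAS-stub_liftThree-3.md` §2).

Helper lemmas offered: L0 (XS), L1 (XS, proved), L2 (M, NEW), L2f (S), L3a (XS), L4 (XS, proved from
L0–L2).

[cite: Wiles1995, Thm. 0.2 (ii)(a)(b), Ch. 1 §1 (deformation data 𝒟 = (·, Σ, 𝒪, ℳ); "ord", "flat", "strict")]
[cite: ConradDiamondTaylor1999, Thm. 7.2.1; §1 (types at 3)] [cite: Diamond1996, Thm. 1.1, §1 (θ via Tate parametrisation)]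
[cite: Greenberg1991, §2] [cite: SerreInventiones1972, §1.11 Prop. 11, §1.12 Prop. 12, App. A.1.2]
[cite: SilvermanATAEC1994, Thm. V.5.3, Cor. V.5.4, Prop. V.6.1 (proof), Remark IV.5.4.1]
-/

set_option linter.dupNamespace false
set_option linter.unusedVariables false

open scoped MatrixGroups NumberField
open Matrix Field IsDedekindDomain IsDedekindDomain.HeightOneSpectrum
open Literature.NumberTheory.EllipticCurves Literature.NumberTheory.EllipticCurves.ModularForms
open Literature.NumberTheory.Automorphic Literature.NumberTheory.Automorphic.BCDT
open Literature.NumberTheory.GaloisRepresentations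
open Literature.NumberTheory.GaloisRepresentations.ModPGaloisRep
open Literature.NumberTheory.DiophantineGeometry
open WeierstrassCurve

noncomputable section

namespace Summit.ABC.ABC.Cruxes.FreyModularity.StubIdeas3G7

/-- The stub, verbatim (`Lines/Sketch.lean:157`). -/
def LiftThree : Prop :=
  ∀ (W : WeierstrassCurve ℚ) [W.IsElliptic] (ρ : ModPGaloisRep ℚ (ZMod 3) 2),
    W.IsTorsionGaloisRep 3 ρ → ρ.IsAbsIrreducibleOverSqrt (-3) → ¬ 9 ∣ W.conductorNorm ℤ →
    ρ.IsModular → W.IsModularGaloisRepTate 3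

/-! ## The one predicate of the ORDINARY column -/

/-- **`HasOrdinaryLineAt W p v` — the ordinary filtration of `V_p E` at the finite place `v`**: a
`Γ_{K_v}`-stable `ℚ_p`-line `L ⊂ V_p E` on which the inertia group `I_{K_v}` acts through the `p`-adic
cyclotomic character `χ_p` of `K_v` and such that `I_{K_v}` acts trivially on `V_p E / L` — i.e.
`ρ_{E,p}|I_v ∼ (χ_p ∗ ; 0 1)`.  This is VERBATIM the conclusion of the tree's named fact
`ellipticOrdinaryReduction_tateModule_filtration` (Greenberg's formulation), abstracted from its
good-ordinary hypothesis so that the multiplicative case (L2) can share it. [cite: Greenberg1991, §2] -/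
def HasOrdinaryLineAt {K : Type} [Field K] [NumberField K] (W : WeierstrassCurve K) [W.IsElliptic]
    (p : ℕ) [Fact p.Prime] (v : HeightOneSpectrum (𝓞 K)) : Prop :=
  ∃ L : Submodule (Padic p) (W.rationalTateModule p),
    Module.finrank (Padic p) L = 1 ∧
    (∀ (τ : absoluteGaloisGroup (v.adicCompletion K)), ∀ x ∈ L,
      W.rationalGaloisRepTate p (absGaloisRestrict K (v.adicCompletion K) τ) x ∈ L) ∧
    (∀ τ ∈ absInertia (v.adicCompletion K), ∀ x ∈ L,
      W.rationalGaloisRepTate p (absGaloisRestrict K (v.adicCompletion K) τ) x =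
        (((GaloisRep.cyclotomicCharacter (v.adicCompletion K) p τ : (PadicInt p)ˣ) : PadicInt p) :
          Padic p) • x) ∧
    (∀ τ ∈ absInertia (v.adicCompletion K), ∀ x : W.rationalTateModule p,
      W.rationalGaloisRepTate p (absGaloisRestrict K (v.adicCompletion K) τ) x - x ∈ L)

/-- **L1 · cell (γ), the PROVED NEIGHBOUR**: at a place `v ∣ p` of good ORDINARY reduction (`p ∤ a_v`)
`V_p E` has the ordinary line.  This is the tree's theorem
`ellipticOrdinaryReduction_tateModule_filtration_holds` (Greenberg 1991 §2; Serre 1972 §1.11), re-read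
through `HasOrdinaryLineAt`. (XS; proved.) [cite: Greenberg1991, §2] -/
theorem hasOrdinaryLineAt_of_hasGoodReductionAt_of_not_dvd {K : Type} [Field K] [NumberField K]
    (W : WeierstrassCurve K) [W.IsElliptic] (p : ℕ) [Fact p.Prime] (v : HeightOneSpectrum (𝓞 K))
    (hv : (p : 𝓞 K) ∈ v.asIdeal) (hgood : W.HasGoodReductionAt v)
    (hord : ¬ ((p : ℤ) ∣ W.frobeniusTraceAt v)) : HasOrdinaryLineAt W p v :=
  ellipticOrdinaryReduction_tateModule_filtration_holds W p v hv hgood hord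

/-- **L2 · cells (β₀), (β₁), the PERTURBATION — the Tate module at a MULTIPLICATIVE place is ordinary**
(any `p`, any finite place `v`, `v ∣ p` or not).  Split case: by Tate uniformisation
(`Silverman1994_thmV53_tateUniformisation_holds`, PROVED) `E(K̄_v) ≅ K̄_vˣ / q^ℤ` `Γ_{K_v}`-equivariantly,
so `E[pⁿ] ⊇ μ_{pⁿ}` with quotient generated by the class of `q^{1/pⁿ}`, on which `Γ_{K_v}` acts trivially
modulo `μ_{pⁿ}` (Kummer theory; the tree's `KummerTresRamifieProofs` §4 does the level-`p` case): the line
`L = V_p(μ) ⊂ V_p E` carries `χ_p` and `V_p E / L` is trivial — for ALL of `Γ_{K_v}`, a fortiori for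
`I_{K_v}`.  Non-split case: the same after the unramified quadratic twist `δ` of the twisted
uniformisation (`Silverman1994_corV54_…`, PROVED); `δ|I_v = 1`, so the two inertia clauses are unchanged
and `L ⊗ δ` is still `Γ_{K_v}`-stable.  Printed: Serre 1972 App. A.1.2 ("Tate curve: `V_p` is an
extension of `ℚ_p` by `ℚ_p(1)`"), Diamond 1996 §1 (`θ|I_p ∼ (1 ∗; 0 1)` for `p ≠ ℓ`, `(ε ∗; 0 1)` at
`p = ℓ`), DDT 1995 Prop. 2.12(c).  (M; NEW — the one missing curve-side input of the ordinary
deformation condition at a multiplicative `3`.) Why plausibly one prover cycle: every ingredient is in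
the tree (uniformisation, Kummer classes, `rationalTateModule` API of `FramedTateGaloisRep`); the work
is transporting the `Γ_{K_v}`-module structure of `K̄_vˣ/q^ℤ`-torsion to `W.rationalTateModule p`.
[cite: SerreInventiones1972, App. A.1.2] [cite: Diamond1996, §1] [cite: SilvermanATAEC1994, Thm. V.5.3, proof of Prop. V.6.1] -/
theorem hasOrdinaryLineAt_of_hasMultiplicativeReductionAt {K : Type} [Field K] [NumberField K]
    (W : WeierstrassCurve K) [W.IsElliptic] (p : ℕ) [Fact p.Prime] (v : HeightOneSpectrum (𝓞 K))
    (hmult : W.HasMultiplicativeReductionAt v) : HasOrdinaryLineAt W p v := by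
  sorry

/-- **L2f · the framed form = the tree's Skinner–Wiles predicate**: an ordinary line makes the framed
representation `ρ_{E,p} : Γ_K → GL₂(ℚ̄_p)` (`framedTateGaloisRep`) ORDINARY OF WEIGHT `2` WITH INERTIAL
EXPONENT `1` at `v` (`FramedGaloisRep.IsOrdinaryOfWeightAt`: a frame in which `ρ|Γ_{K_v}` is upper
triangular with `θ₁|I = χ_p`, `θ₂|I = 1`).  Pure linear algebra: extend a generator of `L` to a basis of
`V_p E` (`finrank = 2`, `finrank_rationalTateModule_eq_two_holds`), compare frames with
`exists_conj_framedTateGaloisRep_eq_ofBasis` and use frame-invariance `isOrdinaryOfWeightAt_conj_iff`.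
This is the exact hypothesis shape of the tree's ordinary `R = T` statements (`SkinnerWiles1999`,
route `EisensteinDefectOne` items via `isOrdinaryOfWeightAt_iff_padicAlgCl`). (S; proposed.) [folklore] -/
theorem isOrdinaryOfWeightAt_framedTateGaloisRep_of_hasOrdinaryLineAt {K : Type} [Field K]
    [NumberField K] (W : WeierstrassCurve K) [W.IsElliptic] (p : ℕ) [Fact p.Prime]
    (v : HeightOneSpectrum (𝓞 K)) (h : HasOrdinaryLineAt W p v) :
    FramedGaloisRep.IsOrdinaryOfWeightAt p (W.framedTateGaloisRep p) v 2 1 := by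
  sorry

/-! ## The boundary `9 ∤ N_W` and the FLAT column at the residual level -/

/-- **L0 · `9 ∤ N_W` ⇒ semistable at the place of `𝓞 ℚ` above `3`** (Silverman ATAEC IV.10.2(c):
`p² ∣ N ⟺` additive at `p`).  Tree chain: `natGenerator_sq_dvd_conductorNorm_iff` (places of `ℤ`) +
trichotomy `hasGoodReductionAt_or_hasMultiplicativeReductionAt_or_hasAdditiveReductionAt` + the
`ℤ ↔ ℚ_[3] ↔ 𝓞 ℚ` transports `hasGoodReductionAtPrime_primesEquiv_iff_hasGoodReductionAt`,
`hasGoodReductionAtPrime_iff_hasGoodReductionAt_ringOfIntegers`,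
`hasMultiplicativeReductionAtPrime_primesEquiv_iff_hasMultiplicativeReductionAt`,
`hasMultiplicativeReductionAtPrime_iff_hasMultiplicativeReductionAt_ringOfIntegers`
(`natGenerator_eq_of_natCast_mem_asIdeal` pins the prime). (XS; proposed — the hypothesis `hsemi` of
GEN 6 E3 discharged from the stub's own `h9`.) [cite: SilvermanATAEC1994, IV.10.2(c)] -/
theorem hasGoodReductionAt_or_hasMultiplicativeReductionAt_of_not_nine_dvd (W : WeierstrassCurve ℚ)
    [W.IsElliptic] (h9 : ¬ 9 ∣ W.conductorNorm ℤ) (v : HeightOneSpectrum (𝓞 ℚ))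
    (hv : (3 : 𝓞 ℚ) ∈ v.asIdeal) :
    W.HasGoodReductionAt v ∨ W.HasMultiplicativeReductionAt v := by
  sorry

/-- **L3a · cell (α) at the residual level — SUPERSINGULAR ⇒ `E[3]` has no non-zero inertia-fixed
point** (so `ρ̄_{E,3}|I₃` is the fundamental character of level `2`, `ρ̄|G₃` is absolutely irreducible,
and the ORDINARY deformation condition is unavailable: the composition MUST run Wiles' FLAT problem at
`3` here).  Contrapositive of the tree's PROVED `ordinaryReduction_of_inertiaFixed_pTorsion_holds`
(Serre 1972 §1.11–1.12; Silverman VII.3.4(b)) at `K = ℚ`, `p = 3`, where `e(v ∣ 3) = 1 < 3 - 1`.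
On the Frey family this is the GENERIC cell at site (A): `3 ∤ abc ⇒ a₃(E) = 0`
(`frobeniusTrace_freyIntModel_three`). (XS; proposed: instantiate the fact, discharge `e = 1`.)
[cite: SerreInventiones1972, §1.12 Prop. 12] -/
theorem geomTorsion_eq_zero_of_inertia_fixed_of_dvd_frobeniusTraceAt (W : WeierstrassCurve ℚ)
    [W.IsElliptic] (v : HeightOneSpectrum (𝓞 ℚ)) (hv : (3 : 𝓞 ℚ) ∈ v.asIdeal)
    (hgood : W.HasGoodReductionAt v) (hss : (3 : ℤ) ∣ W.frobeniusTraceAt v) :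
    haveI : Fact (Nat.Prime 3) := ⟨Nat.prime_three⟩
    ∀ 𝔓 ∈ v.primesAbove, ∀ P : W.geomTorsion 3,
      (∀ σ ∈ 𝔓.inertia (absoluteGaloisGroup ℚ), σ • P = P) → P = 0 := by
  sorry

/-! ## L4 · the table: for `9 ∤ N_W` the place above `3` is ORDINARY-LINE or GOOD SUPERSINGULAR -/

/-- **L4 · the flat × ordinary dichotomy at `3` under `h9`** (proved from L0, L1, L2): either `V₃ E`
has the ordinary line at `v ∣ 3` (cells (β₀), (β₁), (γ): the ordinary deformation condition, in the
tree's language `IsOrdinaryOfWeightAt 3 ρ_{E,3} v 2 1` by L2f), or `W` has good SUPERSINGULAR reduction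
at `v` (cell (α): flat deformation condition; residually L3a).  Together with GEN 6 E3/E4 (`k(ρ̄) = 4`
iff (β₁)) this is the complete list of local data at `3` the `ℓ = 3` lifting theorem must serve; all
four cells OCCUR in the composition (site (A): (α) iff `3 ∤ abc`, (β) iff `3 ∣ abc`; site (B): the
switched `W'` of `stub_switch` is an opaque `∃`, semistable at `3` by `stub_nineTransfer`, so (γ) cannot
be excluded). (XS; proved modulo L0–L2.) -/
theorem hasOrdinaryLineAt_or_supersingular_of_not_nine_dvd (W : WeierstrassCurve ℚ) [W.IsElliptic]
    (h9 : ¬ 9 ∣ W.conductorNorm ℤ) (v : HeightOneSpectrum (𝓞 ℚ)) (hv : (3 : 𝓞 ℚ) ∈ v.asIdeal) :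
    haveI : Fact (Nat.Prime 3) := ⟨Nat.prime_three⟩
    HasOrdinaryLineAt W 3 v ∨ (W.HasGoodReductionAt v ∧ (3 : ℤ) ∣ W.frobeniusTraceAt v) := by
  haveI : Fact (Nat.Prime 3) := ⟨Nat.prime_three⟩
  rcases hasGoodReductionAt_or_hasMultiplicativeReductionAt_of_not_nine_dvd W h9 v hv with hgood | hmult
  · by_cases hss : (3 : ℤ) ∣ W.frobeniusTraceAt v
    · exact Or.inr ⟨hgood, hss⟩
    · refine Or.inl (hasOrdinaryLineAt_of_hasGoodReductionAt_of_not_dvd W 3 v ?_ hgood hss)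
      exact_mod_cast hv
  · exact Or.inl (hasOrdinaryLineAt_of_hasMultiplicativeReductionAt W 3 v hmult)

end Summit.ABC.ABC.Cruxes.FreyModularity.StubIdeas3G7
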